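import Summits.QuantumFields.YangMills.Theorems.UnitScaleTiltProp7CornerFrameLegsFlatZdLevels
import Summits.QuantumFields.YangMills.Theorems.UnitScaleTiltProp7SymAvgTwDefs
import HarnessLib

/-!
# Route `UnitScaleTilt`, crux K1 (stmt-QuantumFields-19200), LANE II (QB) ∕ (R-LEGS): THE MEMBER READING OF THE FLAT CORNER-FRAME LEGS, PER COARSE BOND —
# `‖r₁X(ŷ(c₋)) − r₁X(ŷ(c₊))‖² ≤ 2C₂·ℓ∕(L−2)·Σ_κ GradE_{X♯(·,κ)}(box(ℓ·ŷ(c₋), 2L²ℓ))`, `r₁X(ŷ) = Σ_{j<K−n} F̂(L^{K−n−j}ŷ)[Q_j(1)X♯]` (✓`fderiv_frameTw_one_apply`'s letters)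
Cell `ym3-torus`, width seat `ym3-torus-px19` (gen 6; pen (R-LEGS)).  THEOREMS ONLY (0 `def`, 0 `sorry`); `--supports stmt-QuantumFields-19200 --as helper`, count-neutral.
YM₃ on T³ is a ladder rung (R3), not d = 4, not Clay; nothing here claims a stub, the crux or the gap.  ℤ³ core = ✓p710195 ∕ ✓p711164; letters ✓p709214.
THE POINT.  The comparison sites of the route are torus sites `y : Site (F.P n) 0` read through `coordT3 y ∈ [0,N_k)³ ⊂ ℤ³`; the target of a coarse bond `c` has `coordT3 c₊ =
coordT3 c₋ + e_μ` EXCEPT across the seam, where it is `coordT3 c₋ + e_μ − N_k e_μ`.  The pulled-back field `X♯ z κ = X⟨transl x₀ z, κ⟩` is `N_K`-periodic and `N_K = Lᵏ·N_k`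
(`k = K − n`), so `r₁X♯` is `N_k`-periodic in `ŷ` (§1–§2) and the seam costs nothing; then the ℤ³ core ✓`normSq_cornerFrameLegs_flat_Zd` applies verbatim (§3).
PROVED (ns `…Prop7CornerFrameLegsFlatMember`): §1 `transl_add_period`, `linQIter_translate`, `sum_Fhat_linQIter_periodic`; §2 `coordT3_tgt` (the seam alternative);
§3 ★★`normSq_cornerFrameLegs_flat_member`.  WHAT REMAINS for the `rlegs_flat` TEXT: the sum over coarse bonds of the top-box energies against the torus gradient energy
(multiplicity `≤ (4L²+3)³`, reindexing `w = ℓa + r` and the block decomposition of the fine torus) — next file.  HONEST SCOPE: bookkeeping; no YM content.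
References: T. Bałaban, CMP 98 (1985) 17–51 [Balaban1985Averaging] ((110)–(112) p.34, (125)–(127) pp.36–37, (160) p.42); CMP 109 (1987) 249–301 [Balaban1987RG1] ((0.1) p.251).
-/

set_option autoImplicit false

noncomputable section

open scoped BigOperators Matrix.Norms.L2Operator
open Finset

namespace Summit.QuantumFields.YangMills.Theorems.Prop7CornerFrameLegsFlatMember

open Literature.MathematicalPhysics.QuantumFieldTheory.Balaban1983to89
open Literature.MathematicalPhysics.QuantumFieldTheory.Balaban1983to89.T3ContinuumYM3Torus
open Literature.MathematicalPhysics.QuantumFieldTheory.Balaban1983to89.B4Eq19LatticeOperators (Zd box unitVec mem_box)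
open T3LevelShift (siteShift coordEquiv coordEquiv_val)
open T3PrintedRegularOrbits (sites_eq)
open B7Prop1Explicit (boxVec e)
open B7Prop3Flat (Fhat)
open B7Prop4Flat (linQIter)
open B10Eq27TorusAxialLog (transl transl_apply transl_add_e)
open Summit.QuantumFields.YangMills.Theorems.Prop7SPrint (basePt)
open Summit.QuantumFields.YangMills.Theorems.Prop7SymAvgTw (coordT3 coordT3_apply)
open Summit.QuantumFields.YangMills.Theorems.Prop7CornerFrameLegsFlatZd (linQIter_eq_smul_avg)
open Summit.QuantumFields.YangMills.Theorems.Prop7CornerFrameLegsFlatZdLevels (Fhat_translate normSq_cornerFrameLegs_flat_Zd)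

variable {F : T3Family} {n K : ℕ}

/-! ## §1 Periodicity of the pulled-back field and of `r₁` -/

/-- `transl y (z + N•v) = transl y z`, `N` the period. [cite: Balaban1987RG1, (0.1) p.251] -/
theorem transl_add_period {P : Params} {j : ℕ} (y : Site P j) (z v : B7Prop1Explicit.Site P.d) :
    transl y (z + ((P.sitesPerDir j : ℕ) : ℤ) • v) = transl y z := by
  funext ν
  rw [transl_apply, transl_apply, Pi.add_apply, Pi.smul_apply, smul_eq_mul]
  push_cast
  rw [ZMod.natCast_self, zero_mul, add_zero]

/-- Translating the field by `Lʲ·v` translates the level-`j` cornered tube by `v`: `Q_j(1)(A∘τ_{Lʲv})(z) = Q_j(1)A(z + v)`. [cite: Balaban1985Averaging, (127) p.37] -/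
theorem linQIter_translate {N : ℕ} (L : ℕ) (hL : 1 ≤ L) (A : Zd 3 → Fin 3 → Matrix (Fin N) (Fin N) ℂ) (j : ℕ) (v z : Zd 3) (κ : Fin 3) :
    linQIter L (fun w κ' => A (w + (((L ^ j : ℕ) : ℤ)) • v) κ') j z κ = linQIter L A j (z + v) κ := by
  rw [linQIter_eq_smul_avg L hL _ j z κ, linQIter_eq_smul_avg L hL A j (z + v) κ]
  congr 2
  refine Finset.sum_congr rfl fun σ _ => ?_
  congr 1
  rw [smul_add]
  abel

/-- ★ **`r₁X♯` is `N_k`-periodic in the comparison coordinates** when `X♯` is `N_K`-periodic and `N_K = Lᵏ·N_k`: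
`Σ_{j<k} F̂(L^{k−j}(y + N_k v))[Q_j(1)X♯] = Σ_{j<k} F̂(L^{k−j}y)[Q_j(1)X♯]`. [cite: Balaban1985Averaging, (110) p.34, (127) p.37] -/
theorem sum_Fhat_linQIter_periodic {N : ℕ} (L : ℕ) (hL : 1 ≤ L) (A : Zd 3 → Fin 3 → Matrix (Fin N) (Fin N) ℂ) (k Nk : ℕ)
    (hA : ∀ (w u : Zd 3) (κ : Fin 3), A (w + (((L ^ k * Nk : ℕ) : ℤ)) • u) κ = A w κ) (y v : Zd 3) :
    ∑ j ∈ Finset.range k, Fhat L (linQIter L A j) ((((L ^ (k - j) : ℕ) : ℤ)) • (y + ((Nk : ℕ) : ℤ) • v))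
      = ∑ j ∈ Finset.range k, Fhat L (linQIter L A j) ((((L ^ (k - j) : ℕ) : ℤ)) • y) := by
  refine Finset.sum_congr rfl fun j hj => ?_
  rw [Finset.mem_range] at hj
  rw [smul_add, ← Fhat_translate]
  congr 1
  funext w κ
  -- `Q_j(1)A (w + L^{k-j}N_k v) = Q_j(1)(A∘τ_{Lʲ·L^{k-j}N_k v})(w) = Q_j(1)A(w)`
  have h := linQIter_translate L hL A j ((((L ^ (k - j) : ℕ) : ℤ)) • (((Nk : ℕ) : ℤ) • v)) w κ
  rw [← h]
  congr 1
  funext w' κ'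
  rw [smul_smul, smul_smul]
  have e : (((L ^ j : ℕ) : ℤ)) * (((L ^ (k - j) : ℕ) : ℤ)) * ((Nk : ℕ) : ℤ) = (((L ^ k * Nk : ℕ) : ℤ)) := by
    push_cast
    rw [← pow_add, Nat.add_sub_cancel' hj.le]
  rw [e, hA]

/-! ## §2 The seam: `coordT3 c₊` against `coordT3 c₋ + e_μ` -/

/-- ★ **THE SEAM ALTERNATIVE**: `coordT3 c₊ = coordT3 c₋ + e_μ − w•e_μ` with `w ∈ {0, N_k}`, `N_k = #T^{(k)}` per direction. [cite: Balaban1987RG1, (0.1) p.251] -/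
theorem coordT3_tgt (h : n ≤ K) (c : PBond (F.P n) 0) :
    ∃ w : ℤ, (w = 0 ∨ w = (((F.PP F.m K).sitesPerDir (K - n) : ℕ) : ℤ)) ∧
      (fun i : Fin 3 => coordT3 F n K h c.tgt i) = (fun i : Fin 3 => coordT3 F n K h c.src i) + e (d := 3) c.dir - w • e (d := 3) c.dir := by
  classical
  -- the target coordinate in direction `dir` is the successor, the others are unchanged
  have e1 : c.tgt c.dir = c.src c.dir + 1 := by simp [PBond.tgt, Site.shift]
  have e2 : ∀ μ, μ ≠ c.dir → c.tgt μ = c.src μ := fun μ hμ => by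
    show Function.update c.src c.dir (c.src c.dir + 1) μ = c.src μ
    exact Function.update_of_ne hμ _ _
  have htgt : siteShift (sites_eq F n K h) c.tgt c.dir = siteShift (sites_eq F n K h) c.src c.dir + 1 := by
    show coordEquiv (sites_eq F n K h) (c.tgt c.dir) = coordEquiv (sites_eq F n K h) (c.src c.dir) + 1
    rw [e1]
    exact (map_add _ _ _).trans (congrArg _ (map_one (coordEquiv (sites_eq F n K h))))
  have hoth : ∀ μ, μ ≠ c.dir → siteShift (sites_eq F n K h) c.tgt μ = siteShift (sites_eq F n K h) c.src μ := by
    intro μ hμ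
    show coordEquiv (sites_eq F n K h) (c.tgt μ) = coordEquiv (sites_eq F n K h) (c.src μ)
    rw [e2 μ hμ]
  -- the value of a successor in `ZMod N'`
  have hval : ∀ b : ZMod ((F.PP F.m K).sitesPerDir (K - n)), ∃ q : ℕ, q ≤ 1 ∧
      (((b + 1).val : ℕ) : ℤ) = (b.val : ℤ) + 1 - ((((F.PP F.m K).sitesPerDir (K - n) : ℕ) : ℤ)) * q := by
    intro b
    have hN0 : 0 < (F.PP F.m K).sitesPerDir (K - n) := Nat.pos_of_ne_zero ((F.PP F.m K).sitesPerDir_ne_zero _)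
    rcases Nat.lt_or_ge 1 ((F.PP F.m K).sitesPerDir (K - n)) with h1 | h1
    · refine ⟨(b.val + 1) / (F.PP F.m K).sitesPerDir (K - n), ?_, ?_⟩
      · have hb : b.val + 1 ≤ (F.PP F.m K).sitesPerDir (K - n) := ZMod.val_lt b
        calc (b.val + 1) / (F.PP F.m K).sitesPerDir (K - n) ≤ (F.PP F.m K).sitesPerDir (K - n) / (F.PP F.m K).sitesPerDir (K - n) := Nat.div_le_div_right hb
          _ = 1 := Nat.div_self hN0
      · rw [ZMod.val_add, ZMod.val_one'' (by omega)]
        have hmod := Nat.mod_add_div (b.val + 1) ((F.PP F.m K).sitesPerDir (K - n))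
        have hmod' : ((((b.val + 1) % (F.PP F.m K).sitesPerDir (K - n) : ℕ) : ℤ))
            + ((((F.PP F.m K).sitesPerDir (K - n) : ℕ) : ℤ)) * ((((b.val + 1) / (F.PP F.m K).sitesPerDir (K - n) : ℕ) : ℤ)) = (b.val : ℤ) + 1 := by
          exact_mod_cast hmod
        linarith
    · -- `N' = 1`: every value is `0`
      have hN1 : (F.PP F.m K).sitesPerDir (K - n) = 1 := le_antisymm h1 hN0
      refine ⟨1, le_rfl, ?_⟩
      have hb0 : b.val = 0 := by have := ZMod.val_lt b; omega
      have hb1 : (b + 1).val = 0 := by have := ZMod.val_lt (b + 1); omega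
      rw [hb0, hb1, hN1]
      norm_num
  obtain ⟨q, hq1, hq⟩ := hval (siteShift (sites_eq F n K h) c.src c.dir)
  refine ⟨((((F.PP F.m K).sitesPerDir (K - n) : ℕ) : ℤ)) * q, ?_, ?_⟩
  · rcases Nat.le_one_iff_eq_zero_or_eq_one.mp hq1 with h0 | h1
    · left; rw [h0]; simp
    · right; rw [h1]; simp
  · funext μ
    simp only [Pi.sub_apply, Pi.add_apply, Pi.smul_apply, smul_eq_mul, coordT3_apply]
    by_cases hμ : μ = c.dir
    · subst hμ
      simp only [e, Pi.single_eq_same, mul_one]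
      rw [htgt]
      linarith [hq]
    · rw [hoth μ hμ]
      simp only [e, Pi.single_eq_of_ne hμ, mul_zero, add_zero, sub_zero]

/-! ## §3 The member reading, per coarse bond -/

set_option maxHeartbeats 400000 in
-- HEARTBEAT rule (README): the `r₁` letters and the top-box energy are long terms; measured > 200k; decl-local.
/-- ★★ **THE FLAT CORNER-FRAME LEGS AT THE MEMBER, PER COARSE BOND** (`k = K − n`, `ℓ = Lᵏ`, `X♯ z κ = X⟨transl x₀ z, κ⟩`, `x₀ = basePt F n K`):
`‖r₁X(ŷ(c₋)) − r₁X(ŷ(c₊))‖² ≤ 2C₂·(ℓ∕(L−2))·Σ_κ GradE_{X♯(·,κ)}(box(ℓ·ŷ(c₋), 2L^{k+2}))` with `r₁X(ŷ) := Σ_{j<k} F̂_L(Q_j(1)X♯)(L^{k−j}•ŷ)` — the letters of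
✓`Prop7FlatFrameResponse.fderiv_frameTw_one_apply` — and `C₂` the L-only constant of ✓`normSq_cornerFrameLegs_flat_Zd`; the seam is absorbed by periodicity (§1–§2).
[cite: Balaban1985Averaging, (110)–(112) p.34, (125)–(127) pp.36–37, (160) p.42] -/
theorem normSq_cornerFrameLegs_flat_member (h : n ≤ K) (c : PBond (F.P n) 0) (X : PBond (F.P K) 0 → Matrix (Fin 2) (Fin 2) ℂ) :
    ‖(∑ j ∈ Finset.range (K - n), Fhat (F.P K).L (linQIter (F.P K).L (fun (z : Zd 3) (κ : Fin 3) => X ⟨transl (basePt F n K) z, κ⟩) j)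
          ((((F.P K).L : ℤ) ^ (K - n - j)) • (fun i : Fin 3 => coordT3 F n K h c.src i)))
      - (∑ j ∈ Finset.range (K - n), Fhat (F.P K).L (linQIter (F.P K).L (fun (z : Zd 3) (κ : Fin 3) => X ⟨transl (basePt F n K) z, κ⟩) j)
          ((((F.P K).L : ℤ) ^ (K - n - j)) • (fun i : Fin 3 => coordT3 F n K h c.tgt i)))‖ ^ 2
      ≤ 2 * (9 * ((F.P K).L : ℝ) ^ 2 * (6 * ((F.P K).L : ℝ) + 1) ^ 3 * 4
              * (3 * (10 * (2 : ℕ) + (5 * (2 : ℕ) * ((F.P K).L : ℝ) ^ 2 / 32) * (((F.P K).L : ℝ) / (Real.sqrt (F.P K).L - 1) ^ 2 + 1))))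
          * ((((F.P K).L : ℝ)) ^ (K - n) / (((F.P K).L : ℝ) - 2))
          * ∑ κ : Fin 3, ∑ z ∈ box (((((F.P K).L ^ (K - n) : ℕ) : ℤ)) • (fun i : Fin 3 => coordT3 F n K h c.src i)) (2 * (((F.P K).L ^ (K - n + 2) : ℕ) : ℤ)),
              ∑ ν : Fin 3,
              (if z + unitVec ν ∈ box (((((F.P K).L ^ (K - n) : ℕ) : ℤ)) • (fun i : Fin 3 => coordT3 F n K h c.src i)) (2 * (((F.P K).L ^ (K - n + 2) : ℕ) : ℤ))
                then ‖X ⟨transl (basePt F n K) (z + unitVec ν), κ⟩ - X ⟨transl (basePt F n K) z, κ⟩‖ ^ 2 else 0) := by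
  have hL3 : 3 ≤ (F.P K).L := by
    obtain ⟨r, hr⟩ := F.hL.1
    have h1 := F.hL.2
    show 3 ≤ F.L
    omega
  have hL1 : 1 ≤ (F.P K).L := by omega
  -- `X♯` is `N_K`-periodic, `N_K = Lᵏ·N_k`
  have hNK : (F.P K).L ^ (K - n) * (F.PP F.m K).sitesPerDir (K - n) = (F.P K).sitesPerDir 0 := by
    simp only [Params.sitesPerDir, T3Family.PP_L, T3Family.PP_m, T3Family.PP_K, T3Family.P_eq_PP, Nat.sub_zero]
    have hm : K - n ≤ F.m + K := by omega
    have : F.L ^ (F.m + K) = F.L ^ (F.m + K - (K - n)) * F.L ^ (K - n) := by rw [← pow_add, Nat.sub_add_cancel hm]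
    rw [this]; ring
  have hper : ∀ (w' u : Zd 3) (κ : Fin 3), (fun (z : Zd 3) (κ : Fin 3) => X ⟨transl (basePt F n K) z, κ⟩)
      (w' + ((((F.P K).L ^ (K - n) * (F.PP F.m K).sitesPerDir (K - n) : ℕ) : ℤ)) • u) κ
        = (fun (z : Zd 3) (κ : Fin 3) => X ⟨transl (basePt F n K) z, κ⟩) w' κ := by
    intro w' u κ
    beta_reduce
    rw [hNK]
    have ht : transl (basePt F n K) (w' + ((((F.P K).sitesPerDir 0 : ℕ) : ℤ)) • u) = transl (basePt F n K) w' := by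
      funext ν
      rw [transl_apply, transl_apply]
      show basePt F n K ν + (((w' ν + ((((F.P K).sitesPerDir 0 : ℕ) : ℤ)) * u ν : ℤ)) : ZMod ((F.P K).sitesPerDir 0))
        = basePt F n K ν + ((w' ν : ℤ) : ZMod ((F.P K).sitesPerDir 0))
      push_cast
      rw [ZMod.natCast_self, zero_mul, add_zero]
    rw [ht]
  have hcast : ∀ j, (((F.P K).L : ℤ) ^ (K - n - j)) = ((((F.P K).L ^ (K - n - j) : ℕ) : ℤ)) := fun j => by push_cast; rfl
  simp_rw [hcast]
  -- the seam: replace `coordT3 c₊` by `coordT3 c₋ + e_μ`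
  obtain ⟨w, hw, htgt⟩ := coordT3_tgt (F := F) h c
  rw [htgt]
  have hseam : ∑ j ∈ Finset.range (K - n), Fhat (F.P K).L (linQIter (F.P K).L (fun (z : Zd 3) (κ : Fin 3) => X ⟨transl (basePt F n K) z, κ⟩) j)
          (((((F.P K).L ^ (K - n - j) : ℕ) : ℤ)) • ((fun i : Fin 3 => coordT3 F n K h c.src i) + e (d := 3) c.dir - w • e (d := 3) c.dir))
      = ∑ j ∈ Finset.range (K - n), Fhat (F.P K).L (linQIter (F.P K).L (fun (z : Zd 3) (κ : Fin 3) => X ⟨transl (basePt F n K) z, κ⟩) j)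
          (((((F.P K).L ^ (K - n - j) : ℕ) : ℤ)) • ((fun i : Fin 3 => coordT3 F n K h c.src i) + e (d := 3) c.dir)) := by
    rcases hw with h0 | hN
    · rw [h0, zero_smul, sub_zero]
    · have hp := sum_Fhat_linQIter_periodic (F.P K).L hL1 (fun (z : Zd 3) (κ : Fin 3) => X ⟨transl (basePt F n K) z, κ⟩) (K - n)
        ((F.PP F.m K).sitesPerDir (K - n)) hper ((fun i : Fin 3 => coordT3 F n K h c.src i) + e (d := 3) c.dir) (-(e (d := 3) c.dir))
      have hv : (fun i : Fin 3 => coordT3 F n K h c.src i) + e (d := 3) c.dir - w • e (d := 3) c.dir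
          = ((fun i : Fin 3 => coordT3 F n K h c.src i) + e (d := 3) c.dir) + ((((F.PP F.m K).sitesPerDir (K - n) : ℕ) : ℤ)) • (-(e (d := 3) c.dir)) := by
        rw [hN, smul_neg, sub_eq_add_neg]
      rw [hv, hp]
  rw [hseam, ← Finset.sum_sub_distrib]
  have hZ := normSq_cornerFrameLegs_flat_Zd (N := 2) (F.P K).L hL3 (fun (z : Zd 3) (κ : Fin 3) => X ⟨transl (basePt F n K) z, κ⟩) (K - n)
    (fun i : Fin 3 => coordT3 F n K h c.src i) c.dir
  beta_reduce at hZ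
  exact hZ

end Summit.QuantumFields.YangMills.Theorems.Prop7CornerFrameLegsFlatMember

end
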